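import Literature.AlgebraicTopology.CharacteristicClasses.ProjectiveBundleLine
import Literature.AlgebraicTopology.CharacteristicClasses.ProjectiveCompletionParts
import HarnessLib

/-!
# Maps of projective bundles induced by fibrewise linear bundle maps, and `P(Ψ)^* x = x`

D. Husemoller, *Fibre Bundles* (3rd ed. 1994), Ch. 17 Prop. 3.3 (proof): "for a map `f : B₁ → B`
there is an `f`-morphism of bundles `u : P(f^*(ξ)) → P(ξ)` … `u^*(λ_ξ)` and `λ_{f^*(ξ)}` are
isomorphic. Therefore … `u^*(a_ξ) = a_{f^*(ξ)}`", and §6 Prop. 6.1 (proof), where the same is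
used for the projection of the tautological line onto a summand over the open set where it is
non-zero. We treat both at once: a bundle map `Ψ = (g, φ) : E₁ → E₂` of complex vector bundles,
fibrewise LINEAR (not necessarily injective) with continuous total map, induces

* `mapDom`: the open set `D = {m ∈ P(E₁) : φ(m) ≠ 0}` of lines not killed by `φ`;
* `projBundleMap : D → P(E₂)`, `(b, ℓ) ↦ (g b, φ_b ℓ)`, continuous;
* over any `ζ : Z → D`, a bundle map of the tautological LINE bundles `ζ^*λ₁ → λ₂` over
  `P(Ψ) ∘ ζ`, a fibrewise isomorphism with continuous total map (`lineBundleMapEquiv`,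
  `continuous_lineBundleMap`);
* **`map_lineEuler_eq`**: for `Z` paracompact Hausdorff, `ζ^* x₁ = (P(Ψ) ∘ ζ)^* x₂`
  (`x = e(λ)`, naturality of the Euler class `eulerClass_pullback`, `eulerClass_bundleMap`).

A criterion for continuity of maps INTO a projective bundle (`continuousAt_proj_of_eventuallyEq`)
is included. Everything is proved; no named facts.

## References

* D. Husemoller, *Fibre Bundles*, GTM 20, Springer 1994, Ch. 17 Prop. 3.3, Prop. 6.1. [HusemollerFibreBundles1994]
-/

noncomputable section

open CategoryTheory Function Set Bundle Module Filter Literature.AlgebraicTopology.SingularHomology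
open scoped LinearAlgebra.Projectivization Topology

namespace Literature.AlgebraicTopology.CharacteristicClasses

open ComplexVectorBundle

namespace ComplexVectorBundle

/-! ### Continuity of maps into `P(E)` -/

section IntoProj

variable {B : Type} [TopologicalSpace B] (E : ComplexVectorBundle.{0, 0} B)

/-- **A map `z ↦ (β z, [w z])` into `P(E)` is continuous at `z₀` if `z ↦ (β z, w z) ∈ E` is**
(read in the projectivised chart at `β z₀`: `[e(w z)]`), and so is any map eventually equal to
it. [cite: HusemollerFibreBundles1994, Ch. 17 Def. 2.1] -/
theorem continuousAt_proj_of_eventuallyEq {Z : Type} [TopologicalSpace Z] (G : Z → E.Proj) (z₀ : Z) (β : Z → B)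
    (w : ∀ z, E.E (β z)) (hw : ∀ z, w z ≠ 0) (hc : ContinuousAt (fun z ↦ (⟨β z, w z⟩ : TotalSpace E.F E.E)) z₀)
    (hG : G =ᶠ[𝓝 z₀] fun z ↦ ⟨β z, Projectivization.mk ℂ (w z) (hw z)⟩) : ContinuousAt G z₀ := by
  refine ContinuousAt.congr ?_ hG.symm
  rw [FiberBundle.continuousAt_totalSpace]
  constructor
  · exact ((FiberBundle.continuous_proj E.F E.E).continuousAt.comp hc :)
  · set e := E.triv (β z₀)
    change ContinuousAt (fun z ↦ (projPretrivialization ℂ E.F E.E e ⟨β z, Projectivization.mk ℂ (w z) (hw z)⟩).2) z₀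
    simp only [projPretrivialization_apply, Projectivization.map_mk]
    have h0 : ∀ z, ((linEquivAt ℂ E.F E.E e (β z) : E.E (β z) →L[ℂ] E.F) : E.E (β z) →ₗ[ℂ] E.F) (w z) ≠ 0 := fun z ↦
      (linEquivAt ℂ E.F E.E e (β z)).injective.ne_iff' (map_zero _) |>.2 (hw z)
    refine ContinuousAt.projectivizationMk ?_ h0
    have hev : ∀ᶠ z in 𝓝 z₀, β z ∈ e.baseSet :=
      ((FiberBundle.continuous_proj E.F E.E).continuousAt.comp hc).preimage_mem_nhds
        (e.open_baseSet.mem_nhds (FiberBundle.mem_baseSet_trivializationAt' (β z₀)))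
    refine ContinuousAt.congr (f := fun z ↦ (e ⟨β z, w z⟩).2) ?_ ?_
    · exact continuousAt_snd.comp ((e.continuousAt (e.mem_source.2 (FiberBundle.mem_baseSet_trivializationAt' (β z₀)))).comp hc)
    · filter_upwards [hev] with z hz
      exact (linEquivAt_apply (K := ℂ) e hz (w z)).symm

end IntoProj

/-! ### The bundle map data -/

section Map

variable {B₁ B₂ : Type} [TopologicalSpace B₁] [TopologicalSpace B₂]
  (E₁ : ComplexVectorBundle.{0, 0} B₁) (E₂ : ComplexVectorBundle.{0, 0} B₂) (k₁ : Fin E₁.rank) (k₂ : Fin E₂.rank)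
  {g : C(B₁, B₂)} (φ : ∀ b, E₁.E b →ₗ[ℂ] E₂.E (g b))
  (hΨ : Continuous fun p : TotalSpace E₁.F E₁.E ↦ (⟨g p.proj, φ p.proj p.2⟩ : TotalSpace E₂.F E₂.E))

/-- **The image `φ(u(m))` of the adapted spanning vector of the line `m`.** [cite: HusemollerFibreBundles1994, Ch. 17 Prop. 3.3] -/
def imVec (m : E₁.Proj) : E₂.E (g m.proj) := φ m.proj (E₁.lineVecIn k₁ (E₁.chartAt k₁ m) m)

/-- In another chart: `φ(u_α(m)) = c_{α α(m)}(m) • φ(u(m))`. [folklore] -/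
theorem apply_lineVecIn_eq_smul {α : E₁.FrameIndex} {m : E₁.Proj} (hα : m ∈ E₁.chartSet k₁ α) :
    φ m.proj (E₁.lineVecIn k₁ α m) = E₁.transScalar k₁ α (E₁.chartAt k₁ m) m • E₁.imVec E₂ k₁ φ m := by
  rw [imVec, ← map_smul, ← lineVecIn_eq_smul hα (E₁.mem_chartSet_chartAt k₁ m)]

/-- The transition scalars are non-zero. [folklore] -/
theorem transScalar_ne_zero {α β : E₁.FrameIndex} {m : E₁.Proj} (hα : m ∈ E₁.chartSet k₁ α) (hβ : m ∈ E₁.chartSet k₁ β) :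
    E₁.transScalar k₁ α β m ≠ 0 := (frameChange_lineRep hα hβ).1

/-- **The domain `D = {m : φ(u(m)) ≠ 0}` of `P(Ψ)`** (all of `P(E₁)` when `φ` is injective). [cite: HusemollerFibreBundles1994, Ch. 17 Prop. 6.1] -/
def mapDom : Set E₁.Proj := {m | E₁.imVec E₂ k₁ φ m ≠ 0}

/-- Chart-independence of the domain: `m ∈ D ↔ φ(u_α(m)) ≠ 0`. [folklore] -/
theorem mem_mapDom_iff {α : E₁.FrameIndex} {m : E₁.Proj} (hα : m ∈ E₁.chartSet k₁ α) :
    m ∈ E₁.mapDom E₂ k₁ φ ↔ φ m.proj (E₁.lineVecIn k₁ α m) ≠ 0 := by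
  rw [E₁.apply_lineVecIn_eq_smul E₂ k₁ φ hα, smul_ne_zero_iff]
  exact ⟨fun h ↦ ⟨E₁.transScalar_ne_zero k₁ hα (E₁.mem_chartSet_chartAt k₁ m), h⟩, fun h ↦ h.2⟩

/-- For injective `φ` the domain is everything. [folklore] -/
theorem mapDom_eq_univ (hφ : ∀ b, Injective (φ b)) : E₁.mapDom E₂ k₁ φ = univ :=
  eq_univ_of_forall fun m ↦ (hφ m.proj).ne_iff' (map_zero _) |>.2 (lineVecIn_ne_zero (E₁.mem_chartSet_chartAt k₁ m))

/-- `m ↦ (q m, u_α(m)) : P(E₁) → E₁` is continuous on the chart of `α` (it is `λ → E` on the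
local section `c = 1` of `λ`). [folklore] -/
theorem continuousOn_lineVecIn_total (α : E₁.FrameIndex) :
    ContinuousOn (fun m : E₁.Proj ↦ (⟨m.proj, E₁.lineVecIn k₁ α m⟩ : TotalSpace E₁.F E₁.E)) (E₁.chartSet k₁ α) := by
  have h1 : ∀ m ∈ E₁.chartSet k₁ α, (⟨m.proj, E₁.lineVecIn k₁ α m⟩ : TotalSpace E₁.F E₁.E) =
      E₁.lineIncl k₁ (((E₁.lineCore k₁).localTriv α).toOpenPartialHomeomorph.symm (m, 1)) := by
    intro m hm
    rw [← ((E₁.lineCore k₁).localTriv α).mk_symm hm, (E₁.lineCore k₁).localTriv_symm_apply (i := α) hm]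
    change _ = (⟨m.proj, ((E₁.lineCore k₁).coordChange α (E₁.chartAt k₁ m) m 1) • E₁.lineVecIn k₁ (E₁.chartAt k₁ m) m⟩ :
      TotalSpace E₁.F E₁.E)
    rw [coordChange_smul_lineVecIn E₁ k₁ hm, one_smul]
  refine ContinuousOn.congr ?_ h1
  refine (E₁.continuous_lineIncl k₁).comp_continuousOn ?_
  refine ((E₁.lineCore k₁).localTriv α).toOpenPartialHomeomorph.continuousOn_symm.comp
    (continuousOn_id.prodMk continuousOn_const) fun m hm ↦ ?_
  rw [Trivialization.mem_target]
  exact hm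

/-- A linear trivialisation detects non-zero vectors: `(e v).2 ≠ 0 ↔ v ≠ 0` over its base set. [folklore] -/
theorem trivialization_snd_ne_zero_iff {b : B₂} (e : Trivialization E₂.F (π E₂.F E₂.E)) [e.IsLinear ℂ] (hb : b ∈ e.baseSet)
    (v : E₂.E b) : (e ⟨b, v⟩).2 ≠ 0 ↔ v ≠ 0 := by
  rw [← linEquivAt_apply (K := ℂ) e hb v]
  exact (linEquivAt ℂ E₂.F E₂.E e b).injective.ne_iff' (map_zero _)

include hΨ in
/-- **`D` is open.** [folklore] -/
theorem isOpen_mapDom : IsOpen (E₁.mapDom E₂ k₁ φ) := by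
  rw [isOpen_iff_forall_mem_open]
  intro m₀ hm₀
  set α := E₁.chartAt k₁ m₀
  set e := E₂.triv (g m₀.proj)
  let G : E₁.Proj → TotalSpace E₂.F E₂.E := fun m ↦ ⟨g m.proj, φ m.proj (E₁.lineVecIn k₁ α m)⟩
  have hG : ContinuousOn G (E₁.chartSet k₁ α) := hΨ.comp_continuousOn (E₁.continuousOn_lineVecIn_total k₁ α)
  set O : Set E₁.Proj := E₁.chartSet k₁ α ∩ G ⁻¹' (TotalSpace.proj ⁻¹' e.baseSet)
  have hO : IsOpen O := hG.isOpen_inter_preimage (isOpen_chartSet (E := E₁) (k₀ := k₁) α)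
    (e.open_baseSet.preimage (FiberBundle.continuous_proj E₂.F E₂.E))
  have hGe : ContinuousOn (fun m ↦ (e (G m)).2) O :=
    continuousOn_snd.comp (e.continuousOn.comp (hG.mono inter_subset_left) fun m hm ↦ by
      rw [e.mem_source]; exact hm.2) (mapsTo_univ _ _)
  refine ⟨O ∩ (fun m ↦ (e (G m)).2) ⁻¹' {v | v ≠ 0}, fun m hm ↦ ?_, hGe.isOpen_inter_preimage hO isOpen_ne, ?_⟩
  · have h1 : (e (G m)).2 ≠ 0 := hm.2
    rw [E₂.trivialization_snd_ne_zero_iff e hm.1.2] at h1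
    exact (E₁.mem_mapDom_iff E₂ k₁ φ hm.1.1).2 h1
  · have hb : g m₀.proj ∈ e.baseSet := FiberBundle.mem_baseSet_trivializationAt' (g m₀.proj)
    refine ⟨⟨E₁.mem_chartSet_chartAt k₁ m₀, hb⟩, ?_⟩
    change (e (G m₀)).2 ≠ 0
    rw [E₂.trivialization_snd_ne_zero_iff e hb]
    exact (E₁.mem_mapDom_iff E₂ k₁ φ (E₁.mem_chartSet_chartAt k₁ m₀)).1 hm₀

/-- **The induced map `P(Ψ) : D → P(E₂)`, `(b, ℓ) ↦ (g b, φ_b ℓ)`.** [cite: HusemollerFibreBundles1994, Ch. 17 Prop. 3.3] -/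
def projBundleMapFun (m : ↥(E₁.mapDom E₂ k₁ φ)) : E₂.Proj := ⟨g m.1.proj, Projectivization.mk ℂ (E₁.imVec E₂ k₁ φ m.1) m.2⟩

/-- In any chart: `P(Ψ)(m) = (g b, [φ(u_α(m))])`. [folklore] -/
theorem projBundleMapFun_eq {α : E₁.FrameIndex} (m : ↥(E₁.mapDom E₂ k₁ φ)) (hα : m.1 ∈ E₁.chartSet k₁ α) :
    E₁.projBundleMapFun E₂ k₁ φ m = ⟨g m.1.proj, Projectivization.mk ℂ (φ m.1.proj (E₁.lineVecIn k₁ α m.1))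
      ((E₁.mem_mapDom_iff E₂ k₁ φ hα).1 m.2)⟩ := by
  rw [projBundleMapFun]
  congr 1
  symm
  rw [Projectivization.mk_eq_mk_iff]
  exact ⟨Units.mk0 _ (E₁.transScalar_ne_zero k₁ hα (E₁.mem_chartSet_chartAt k₁ m.1)),
    by rw [Units.smul_mk0]; exact (E₁.apply_lineVecIn_eq_smul E₂ k₁ φ hα).symm⟩

include hΨ in
/-- **`P(Ψ)` is continuous.** [cite: HusemollerFibreBundles1994, Ch. 17 Prop. 3.3] -/
theorem continuous_projBundleMapFun : Continuous (E₁.projBundleMapFun E₂ k₁ φ) := by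
  refine continuous_iff_continuousAt.2 fun m₀ ↦ ?_
  set α := E₁.chartAt k₁ m₀.1
  have hO : IsOpen (Subtype.val ⁻¹' E₁.chartSet k₁ α : Set ↥(E₁.mapDom E₂ k₁ φ)) :=
    (isOpen_chartSet (E := E₁) (k₀ := k₁) α).preimage continuous_subtype_val
  have hmem : m₀ ∈ (Subtype.val ⁻¹' E₁.chartSet k₁ α : Set ↥(E₁.mapDom E₂ k₁ φ)) := E₁.mem_chartSet_chartAt k₁ m₀.1
  -- on the chart, `P(Ψ) = (g b, [φ(u_α(m))])` with `m ↦ (g b, φ(u_α(m)))` continuous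
  have hw : ∀ m : ↥(E₁.mapDom E₂ k₁ φ), m ∈ (Subtype.val ⁻¹' E₁.chartSet k₁ α : Set ↥(E₁.mapDom E₂ k₁ φ)) →
      φ m.1.proj (E₁.lineVecIn k₁ α m.1) ≠ 0 := fun m hm ↦ (E₁.mem_mapDom_iff E₂ k₁ φ hm).1 m.2
  -- restrict to the open chart piece
  rw [← (hO.isOpenEmbedding_subtypeVal).continuousAt_iff (x := ⟨m₀, hmem⟩)]
  refine E₂.continuousAt_proj_of_eventuallyEq (fun m : ↥(Subtype.val ⁻¹' E₁.chartSet k₁ α : Set ↥(E₁.mapDom E₂ k₁ φ)) ↦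
      E₁.projBundleMapFun E₂ k₁ φ m.1) ⟨m₀, hmem⟩ (fun m ↦ g m.1.1.proj) (fun m ↦ φ m.1.1.proj (E₁.lineVecIn k₁ α m.1.1))
    (fun m ↦ hw m.1 m.2) ?_ (Eventually.of_forall fun m ↦ E₁.projBundleMapFun_eq E₂ k₁ φ m.1 m.2)
  exact (hΨ.comp_continuousOn ((E₁.continuousOn_lineVecIn_total k₁ α).comp continuous_subtype_val.continuousOn
    (fun m hm ↦ hm))).comp_continuous continuous_subtype_val (fun m ↦ m.2) |>.continuousAt

/-- **`P(Ψ) : D → P(E₂)` as a continuous map.** [cite: HusemollerFibreBundles1994, Ch. 17 Prop. 3.3] -/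
def projBundleMap : C(↥(E₁.mapDom E₂ k₁ φ), E₂.Proj) := ⟨E₁.projBundleMapFun E₂ k₁ φ, E₁.continuous_projBundleMapFun E₂ k₁ φ hΨ⟩

/-- `P(Ψ)` covers `g`: `q₂ ∘ P(Ψ) = g ∘ q₁`. [folklore] -/
@[simp]
theorem projBundleMap_proj (m : ↥(E₁.mapDom E₂ k₁ φ)) : (E₁.projBundleMap E₂ k₁ φ hΨ m).proj = g m.1.proj := rfl

/-- The value of `P(Ψ)`. [folklore] -/
theorem projBundleMap_apply (m : ↥(E₁.mapDom E₂ k₁ φ)) :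
    E₁.projBundleMap E₂ k₁ φ hΨ m = ⟨g m.1.proj, Projectivization.mk ℂ (E₁.imVec E₂ k₁ φ m.1) m.2⟩ := rfl

/-! ### The bundle map of tautological line bundles over `P(Ψ) ∘ ζ` -/

variable {Z : Type} [TopologicalSpace Z] (ζ : C(Z, E₁.Proj)) (hζ : ∀ z, ζ z ∈ E₁.mapDom E₂ k₁ φ)

/-- `ζ` corestricted to `D`. [folklore] -/
def domLift : C(Z, ↥(E₁.mapDom E₂ k₁ φ)) := ⟨fun z ↦ ⟨ζ z, hζ z⟩, ζ.continuous.subtype_mk _⟩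

/-- `P(Ψ) ∘ ζ : Z → P(E₂)`. [folklore] -/
def projComp : C(Z, E₂.Proj) := (E₁.projBundleMap E₂ k₁ φ hΨ).comp (E₁.domLift E₂ k₁ φ ζ hζ)

/-- The normalised coordinate `φ₀(A_β v)` of a vector `v ∈ E₂` in the frame `β`. [folklore] -/
abbrev frameCoord (β : E₂.FrameIndex) {b : B₂} (v : E₂.E b) : ℂ := E₂.coordFun k₂ (E₂.adaptedFrame β b v)

/-- `φ₀ ∘ A_β` is linear: scalars. [folklore] -/
theorem frameCoord_smul (β : E₂.FrameIndex) {b : B₂} (s : ℂ) (v : E₂.E b) : E₂.frameCoord k₂ β (s • v) = s * E₂.frameCoord k₂ β v := by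
  rw [frameCoord, map_smul, map_smul, smul_eq_mul]

/-- `φ₀(A_β u_β(m)) = 1` on the chart of `β`. [folklore] -/
theorem frameCoord_lineVecIn {β : E₂.FrameIndex} {m : E₂.Proj} (hm : m ∈ E₂.chartSet k₂ β) :
    E₂.frameCoord k₂ β (E₂.lineVecIn k₂ β m) = 1 := by
  rw [frameCoord, adaptedFrame_lineVecIn, φ₀_lineRep hm]

/-- The spanning vector `u_β(P(Ψ)(ζ z))`, typed over `g (q (ζ z))`. [folklore] -/
def uIn (β : E₂.FrameIndex) (z : Z) : E₂.E (g (ζ z).proj) := E₂.lineVecIn k₂ β (E₁.projComp E₂ k₁ φ hΨ ζ hζ z)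

/-- The adapted one, `u(P(Ψ)(ζ z))`. [folklore] -/
def uAt (z : Z) : E₂.E (g (ζ z).proj) := E₁.uIn E₂ k₁ k₂ φ hΨ ζ hζ (E₂.chartAt k₂ (E₁.projComp E₂ k₁ φ hΨ ζ hζ z)) z

/-- Change of frame for these vectors. [folklore] -/
theorem uAt_eq_smul {β : E₂.FrameIndex} {z : Z} (hβ : E₁.projComp E₂ k₁ φ hΨ ζ hζ z ∈ E₂.chartSet k₂ β) :
    E₁.uAt E₂ k₁ k₂ φ hΨ ζ hζ z =
      E₂.transScalar k₂ (E₂.chartAt k₂ (E₁.projComp E₂ k₁ φ hΨ ζ hζ z)) β (E₁.projComp E₂ k₁ φ hΨ ζ hζ z) • E₁.uIn E₂ k₁ k₂ φ hΨ ζ hζ β z :=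
  lineVecIn_eq_smul (E₂.mem_chartSet_chartAt k₂ _) hβ

/-- `φ₀(A_β u_β) = 1`. [folklore] -/
theorem frameCoord_uIn {β : E₂.FrameIndex} {z : Z} (hβ : E₁.projComp E₂ k₁ φ hΨ ζ hζ z ∈ E₂.chartSet k₂ β) :
    E₂.frameCoord k₂ β (E₁.uIn E₂ k₁ k₂ φ hΨ ζ hζ β z) = 1 :=
  E₂.frameCoord_lineVecIn k₂ hβ

/-- `u ≠ 0`. [folklore] -/
theorem uAt_ne_zero (z : Z) : E₁.uAt E₂ k₁ k₂ φ hΨ ζ hζ z ≠ 0 := lineVecIn_ne_zero (E₂.mem_chartSet_chartAt k₂ _)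

/-- **The scalar `s(z)` with `φ(u(ζ z)) = s(z) • u(P(Ψ)(ζ z))`.** [folklore] -/
def mapScalar (z : Z) : ℂ :=
  E₂.frameCoord k₂ (E₂.chartAt k₂ (E₁.projComp E₂ k₁ φ hΨ ζ hζ z)) (E₁.imVec E₂ k₁ φ (ζ z))

/-- `φ(u(ζ z))` lies on the line `P(Ψ)(ζ z)`, spanned by `u(P(Ψ)(ζ z))`: it is a multiple of it. [folklore] -/
theorem exists_imVec_eq_smul (z : Z) : ∃ s : ℂ, E₁.imVec E₂ k₁ φ (ζ z) = s • E₁.uAt E₂ k₁ k₂ φ hΨ ζ hζ z := by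
  let m₂ := E₁.projComp E₂ k₁ φ hΨ ζ hζ z
  let S : Submodule ℂ (E₂.E (g (ζ z).proj)) := Projectivization.submodule (Projectivization.mk ℂ (E₁.imVec E₂ k₁ φ (ζ z)) (hζ z))
  have hu : E₁.uAt E₂ k₁ k₂ φ hΨ ζ hζ z ∈ S := E₂.lineVecIn_mem k₂ (E₂.mem_chartSet_chartAt k₂ m₂)
  have hv : E₁.imVec E₂ k₁ φ (ζ z) ∈ S := by
    change E₁.imVec E₂ k₁ φ (ζ z) ∈ Projectivization.submodule (Projectivization.mk ℂ (E₁.imVec E₂ k₁ φ (ζ z)) (hζ z))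
    rw [Projectivization.submodule_mk]
    exact Submodule.mem_span_singleton_self _
  have h1 : Module.finrank ℂ ↥S = 1 := Projectivization.finrank_submodule _
  have hu0 : (⟨_, hu⟩ : ↥S) ≠ 0 := fun h ↦ E₁.uAt_ne_zero E₂ k₁ k₂ φ hΨ ζ hζ z (congrArg Subtype.val h)
  obtain ⟨s, hs⟩ := (finrank_eq_one_iff_of_nonzero' _ hu0).1 h1 ⟨_, hv⟩
  exact ⟨s, (congrArg Subtype.val hs).symm⟩

/-- **`φ(u(ζ z)) = s(z) • u(P(Ψ)(ζ z))`.** [folklore] -/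
theorem imVec_eq_mapScalar_smul (z : Z) : E₁.imVec E₂ k₁ φ (ζ z) = E₁.mapScalar E₂ k₁ k₂ φ hΨ ζ hζ z • E₁.uAt E₂ k₁ k₂ φ hΨ ζ hζ z := by
  obtain ⟨s, hs⟩ := E₁.exists_imVec_eq_smul E₂ k₁ k₂ φ hΨ ζ hζ z
  have : E₁.mapScalar E₂ k₁ k₂ φ hΨ ζ hζ z = s := by
    rw [mapScalar, hs, frameCoord_smul]
    change s * E₂.frameCoord k₂ _ (E₁.uIn E₂ k₁ k₂ φ hΨ ζ hζ _ z) = s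
    rw [E₁.frameCoord_uIn E₂ k₁ k₂ φ hΨ ζ hζ (E₂.mem_chartSet_chartAt k₂ _), mul_one]
  rw [this, hs]

/-- `s(z) ≠ 0`. [folklore] -/
theorem mapScalar_ne_zero (z : Z) : E₁.mapScalar E₂ k₁ k₂ φ hΨ ζ hζ z ≠ 0 := fun h ↦ by
  have := E₁.imVec_eq_mapScalar_smul E₂ k₁ k₂ φ hΨ ζ hζ z
  rw [h, zero_smul] at this
  exact hζ z this

/-- **The fibre isomorphisms `(ζ^*λ₁)_z ≅ (λ₂)_{P(Ψ)(ζ z)}`, `c ↦ c s(z)`.** [cite: HusemollerFibreBundles1994, Ch. 17 Prop. 3.3] -/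
def lineBundleMapEquiv (z : Z) :
    ((ζ : Z → E₁.Proj) *ᵖ (E₁.lineBundle k₁).E) z ≃L[ℂ] (E₂.lineBundle k₂).E (E₁.projComp E₂ k₁ φ hΨ ζ hζ z) where
  toLinearEquiv := LinearEquiv.smulOfNeZero ℂ ℂ (E₁.mapScalar E₂ k₁ k₂ φ hΨ ζ hζ z) (E₁.mapScalar_ne_zero E₂ k₁ k₂ φ hΨ ζ hζ z)
  continuous_toFun := by
    exact (continuous_const.mul continuous_id : Continuous fun c : ℂ ↦ E₁.mapScalar E₂ k₁ k₂ φ hΨ ζ hζ z * c)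
  continuous_invFun := by
    exact (continuous_const.mul continuous_id : Continuous fun c : ℂ ↦ (E₁.mapScalar E₂ k₁ k₂ φ hΨ ζ hζ z)⁻¹ * c)

/-- Its value: `c ↦ s(z) c`. [folklore] -/
theorem lineBundleMapEquiv_apply (z : Z) (c : ((ζ : Z → E₁.Proj) *ᵖ (E₁.lineBundle k₁).E) z) :
    (E₁.lineBundleMapEquiv E₂ k₁ k₂ φ hΨ ζ hζ z c : ℂ) = E₁.mapScalar E₂ k₁ k₂ φ hΨ ζ hζ z * (show ℂ from c) := rfl

/-- The local coefficient `t(z) = φ₀(A_{β₀} φ(u_{α₀}(ζ z)))` (`α₀`, `β₀` fixed charts). [folklore] -/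
def localCoeff (α₀ : E₁.FrameIndex) (β₀ : E₂.FrameIndex) (z : Z) : ℂ := E₂.frameCoord k₂ β₀ (φ (ζ z).proj (E₁.lineVecIn k₁ α₀ (ζ z)))

include hζ in
/-- **The value of `t`**: `t(z) = c₁[α₀ → α(ζ z)] · s(z) · c₂[α(P z) → β₀]`. [folklore] -/
theorem localCoeff_eq {α₀ : E₁.FrameIndex} {β₀ : E₂.FrameIndex} {z : Z} (hzα : ζ z ∈ E₁.chartSet k₁ α₀)
    (hzβ : E₁.projComp E₂ k₁ φ hΨ ζ hζ z ∈ E₂.chartSet k₂ β₀) :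
    E₁.localCoeff E₂ k₁ k₂ φ ζ α₀ β₀ z = E₁.transScalar k₁ α₀ (E₁.chartAt k₁ (ζ z)) (ζ z) *
      (E₁.mapScalar E₂ k₁ k₂ φ hΨ ζ hζ z *
        E₂.transScalar k₂ (E₂.chartAt k₂ (E₁.projComp E₂ k₁ φ hΨ ζ hζ z)) β₀ (E₁.projComp E₂ k₁ φ hΨ ζ hζ z)) := by
  rw [localCoeff, E₁.apply_lineVecIn_eq_smul E₂ k₁ φ hzα, frameCoord_smul, E₁.imVec_eq_mapScalar_smul E₂ k₁ k₂ φ hΨ ζ hζ z,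
    frameCoord_smul, E₁.uAt_eq_smul E₂ k₁ k₂ φ hΨ ζ hζ hzβ, frameCoord_smul, E₁.frameCoord_uIn E₂ k₁ k₂ φ hΨ ζ hζ hzβ, mul_one]

include hΨ in
/-- **`t` is continuous** near points where the charts apply. [folklore] -/
theorem continuousOn_localCoeff (α₀ : E₁.FrameIndex) (β₀ : E₂.FrameIndex) :
    ContinuousOn (E₁.localCoeff E₂ k₁ k₂ φ ζ α₀ β₀)
      {z | ζ z ∈ E₁.chartSet k₁ α₀ ∧ g (ζ z).proj ∈ (E₂.triv β₀.1).baseSet} := by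
  have h1 : ContinuousOn (fun z ↦ (⟨g (ζ z).proj, φ (ζ z).proj (E₁.lineVecIn k₁ α₀ (ζ z))⟩ : TotalSpace E₂.F E₂.E))
      {z | ζ z ∈ E₁.chartSet k₁ α₀} :=
    (hΨ.comp_continuousOn (E₁.continuousOn_lineVecIn_total k₁ α₀)).comp ζ.continuous.continuousOn fun z hz ↦ hz
  have h2 : ∀ z ∈ {z | ζ z ∈ E₁.chartSet k₁ α₀ ∧ g (ζ z).proj ∈ (E₂.triv β₀.1).baseSet},
      E₁.localCoeff E₂ k₁ k₂ φ ζ α₀ β₀ z =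
        E₂.coordFun k₂ (β₀.2 ((E₂.triv β₀.1) ⟨g (ζ z).proj, φ (ζ z).proj (E₁.lineVecIn k₁ α₀ (ζ z))⟩).2) := by
    rintro z ⟨_, hb⟩
    rw [localCoeff, frameCoord, adaptedFrame, ContinuousLinearEquiv.trans_apply, linEquivAt_apply _ hb]
  refine ContinuousOn.congr ?_ h2
  refine (E₂.coordFun k₂).continuous.comp_continuousOn (β₀.2.continuous.comp_continuousOn ?_)
  refine continuousOn_snd.comp ((E₂.triv β₀.1).continuousOn.comp (h1.mono fun z hz ↦ hz.1) fun z hz ↦ ?_) (mapsTo_univ _ _) |>.mono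
    fun z hz ↦ hz
  rw [(E₂.triv β₀.1).mem_source]
  exact hz.2

/-- **The bundle map `ζ^*λ₁ → λ₂` over `P(Ψ) ∘ ζ` has a continuous total map.** In the charts
`α₀ = α(ζ z₀)`, `β₀ = β(P(Ψ)(ζ z₀))` it reads `(z, c) ↦ c t(z)`. [cite: HusemollerFibreBundles1994, Ch. 17 Prop. 3.3] -/
theorem continuous_lineBundleMap : Continuous fun q : TotalSpace (E₁.lineBundle k₁).F ((ζ : Z → E₁.Proj) *ᵖ (E₁.lineBundle k₁).E) ↦
    (⟨E₁.projComp E₂ k₁ φ hΨ ζ hζ q.proj, E₁.lineBundleMapEquiv E₂ k₁ k₂ φ hΨ ζ hζ q.proj q.2⟩ :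
      TotalSpace (E₂.lineBundle k₂).F (E₂.lineBundle k₂).E) := by
  refine continuous_totalSpace_map (F₁ := (E₁.lineBundle k₁).F) (F₂ := (E₂.lineBundle k₂).F)
    (E₁ := (ζ : Z → E₁.Proj) *ᵖ (E₁.lineBundle k₁).E) (E₂ := (E₂.lineBundle k₂).E)
    (g := E₁.projComp E₂ k₁ φ hΨ ζ hζ) (E₁.projComp E₂ k₁ φ hΨ ζ hζ).continuous
    (fun z c ↦ E₁.lineBundleMapEquiv E₂ k₁ k₂ φ hΨ ζ hζ z c) fun p ↦ ?_
  obtain ⟨z₀, c₀⟩ := p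
  -- fixed charts
  obtain ⟨α₀, hα₀⟩ : ∃ α₀, α₀ = E₁.chartAt k₁ (ζ z₀) := ⟨_, rfl⟩
  obtain ⟨β₀, hβ₀⟩ : ∃ β₀, β₀ = E₂.chartAt k₂ (E₁.projComp E₂ k₁ φ hΨ ζ hζ z₀) := ⟨_, rfl⟩
  -- the neighbourhood where the local formula holds
  let N : Set Z := {z | ζ z ∈ E₁.chartSet k₁ α₀ ∧ g (ζ z).proj ∈ (E₂.triv β₀.1).baseSet ∧
    E₁.projComp E₂ k₁ φ hΨ ζ hζ z ∈ E₂.chartSet k₂ β₀}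
  have hNo : IsOpen N := by
    refine ((isOpen_chartSet (E := E₁) (k₀ := k₁) α₀).preimage ζ.continuous).inter
      ((((E₂.triv β₀.1).open_baseSet.preimage g.continuous).preimage
        ((continuous_projProj ℂ E₁.F E₁.E).comp ζ.continuous)).inter
        ((isOpen_chartSet (E := E₂) (k₀ := k₂) β₀).preimage (E₁.projComp E₂ k₁ φ hΨ ζ hζ).continuous))
  have hz₀N : z₀ ∈ N := by
    refine ⟨hα₀ ▸ E₁.mem_chartSet_chartAt k₁ _, ?_, hβ₀ ▸ E₂.mem_chartSet_chartAt k₂ _⟩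
    have := (E₂.mem_chartSet_chartAt k₂ (E₁.projComp E₂ k₁ φ hΨ ζ hζ z₀)).1
    rw [← hβ₀] at this
    exact this
  -- the local expression: `(z, c) ↦ c₂[α(P z) → β₀] (s z · c₁[α₀ → α(ζ z)] c) = t z · c`
  have hev : ∀ q : Z × (E₁.lineBundle k₁).F, q.1 ∈ N →
      ((trivializationAt (E₂.lineBundle k₂).F (E₂.lineBundle k₂).E (E₁.projComp E₂ k₁ φ hΨ ζ hζ z₀))
        ⟨E₁.projComp E₂ k₁ φ hΨ ζ hζ
            ((trivializationAt (E₁.lineBundle k₁).F ((ζ : Z → E₁.Proj) *ᵖ (E₁.lineBundle k₁).E) z₀).toPartialEquiv.symm q).proj,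
          E₁.lineBundleMapEquiv E₂ k₁ k₂ φ hΨ ζ hζ _
            ((trivializationAt (E₁.lineBundle k₁).F ((ζ : Z → E₁.Proj) *ᵖ (E₁.lineBundle k₁).E) z₀).toPartialEquiv.symm q).2⟩).2 =
      E₁.localCoeff E₂ k₁ k₂ φ ζ α₀ β₀ q.1 * (show ℂ from q.2) := by
    rintro ⟨z, c⟩ ⟨hzα, _, hzβ⟩
    -- the pull-back trivialisation of `ζ^*λ₁` at `z₀` is `(z, c) ↦ (z, c₁[α₀ → α(ζ z)](ζ z) c)`
    have hsymm : (trivializationAt (E₁.lineBundle k₁).F ((ζ : Z → E₁.Proj) *ᵖ (E₁.lineBundle k₁).E) z₀).toPartialEquiv.symm (z, c) =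
        ⟨z, (show (E₁.lineBundle k₁).E (ζ z) from (E₁.lineCore k₁).coordChange α₀ (E₁.chartAt k₁ (ζ z)) (ζ z) c)⟩ := by
      change (⟨z, (trivializationAt (E₁.lineBundle k₁).F (E₁.lineBundle k₁).E (ζ z₀)).symm (ζ z) c⟩ :
        TotalSpace (E₁.lineBundle k₁).F ((ζ : Z → E₁.Proj) *ᵖ (E₁.lineBundle k₁).E)) = _
      congr 1
      rw [hα₀] at hzα ⊢
      exact (E₁.lineCore k₁).localTriv_symm_apply (i := E₁.chartAt k₁ (ζ z₀)) hzα c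
    rw [hsymm]
    change ((E₂.lineCore k₂).localTriv (E₂.chartAt k₂ (E₁.projComp E₂ k₁ φ hΨ ζ hζ z₀))
      ⟨E₁.projComp E₂ k₁ φ hΨ ζ hζ z, E₁.mapScalar E₂ k₁ k₂ φ hΨ ζ hζ z *
        ((E₁.lineCore k₁).coordChange α₀ (E₁.chartAt k₁ (ζ z)) (ζ z) c)⟩).2 = _
    rw [(E₂.lineCore k₂).localTriv_apply, lineCore_coordChange_apply, lineCore_coordChange_apply, lineCore_indexAt, ← hβ₀,
      E₁.localCoeff_eq E₂ k₁ k₂ φ hΨ ζ hζ hzα hzβ]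
    change (E₂.transScalar k₂ (E₂.chartAt k₂ (E₁.projComp E₂ k₁ φ hΨ ζ hζ z)) β₀ (E₁.projComp E₂ k₁ φ hΨ ζ hζ z) *
      (E₁.mapScalar E₂ k₁ k₂ φ hΨ ζ hζ z * (E₁.transScalar k₁ α₀ (E₁.chartAt k₁ (ζ z)) (ζ z) * (show ℂ from c))) : ℂ) =
      E₁.transScalar k₁ α₀ (E₁.chartAt k₁ (ζ z)) (ζ z) * (E₁.mapScalar E₂ k₁ k₂ φ hΨ ζ hζ z *
        E₂.transScalar k₂ (E₂.chartAt k₂ (E₁.projComp E₂ k₁ φ hΨ ζ hζ z)) β₀ (E₁.projComp E₂ k₁ φ hΨ ζ hζ z)) * (show ℂ from c)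
    ring
  have hq₀ : (trivializationAt (E₁.lineBundle k₁).F ((ζ : Z → E₁.Proj) *ᵖ (E₁.lineBundle k₁).E) z₀ ⟨z₀, c₀⟩).1 = z₀ := rfl
  have hmem : (trivializationAt (E₁.lineBundle k₁).F ((ζ : Z → E₁.Proj) *ᵖ (E₁.lineBundle k₁).E) z₀ ⟨z₀, c₀⟩) ∈ (Prod.fst ⁻¹' N : Set (Z × _)) := by
    change (trivializationAt (E₁.lineBundle k₁).F ((ζ : Z → E₁.Proj) *ᵖ (E₁.lineBundle k₁).E) z₀ ⟨z₀, c₀⟩).1 ∈ N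
    rw [hq₀]
    exact hz₀N
  refine ContinuousAt.congr (f := fun q : Z × (E₁.lineBundle k₁).F ↦ E₁.localCoeff E₂ k₁ k₂ φ ζ α₀ β₀ q.1 * (show ℂ from q.2)) ?_
    (Filter.eventuallyEq_of_mem ((hNo.preimage continuous_fst).mem_nhds hmem) fun q hq ↦ (hev q hq).symm)
  have ht : ContinuousAt (fun q : Z × (E₁.lineBundle k₁).F ↦ E₁.localCoeff E₂ k₁ k₂ φ ζ α₀ β₀ q.1)
      (trivializationAt (E₁.lineBundle k₁).F ((ζ : Z → E₁.Proj) *ᵖ (E₁.lineBundle k₁).E) z₀ ⟨z₀, c₀⟩) := by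
    refine ContinuousAt.comp (g := E₁.localCoeff E₂ k₁ k₂ φ ζ α₀ β₀) ?_ continuousAt_fst
    rw [hq₀]
    exact ((E₁.continuousOn_localCoeff E₂ k₁ k₂ φ hΨ ζ α₀ β₀).mono fun z hz ↦ ⟨hz.1, hz.2.1⟩).continuousAt (hNo.mem_nhds hz₀N)
  exact ht.mul (continuousAt_snd (X := Z) (Y := (E₁.lineBundle k₁).F))

/-! ### The Euler classes -/

variable [T2Space B₂] [ParacompactSpace B₂] [T2Space B₁] [ParacompactSpace B₁] [T2Space Z] [ParacompactSpace Z]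
  (R : Type) [CommRing R]

/-- **`ζ^* x₁ = (P(Ψ) ∘ ζ)^* x₂`** for `x = e(λ)` and `ζ : Z → D ⊆ P(E₁)` from a paracompact
Hausdorff `Z` (Husemoller: `u^*(a_ξ) = a_{f^*ξ}`). [cite: HusemollerFibreBundles1994, Ch. 17 Prop. 3.3] -/
theorem map_lineEuler_eq (m : R) :
    singularCohomology.map R R ζ 2 (E₁.lineEuler k₁ R m) =
      singularCohomology.map R R (E₁.projComp E₂ k₁ φ hΨ ζ hζ) 2 (E₂.lineEuler k₂ R m) := by
  rw [lineEuler, lineEuler, ← eulerClass_pullback]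
  exact eulerClass_bundleMap (E₁.lineBundle k₁).F (E₂.lineBundle k₂).F ((ζ : Z → E₁.Proj) *ᵖ (E₁.lineBundle k₁).E)
    (E₂.lineBundle k₂).E (E₁.finrank_lineBundle k₁) (E₂.finrank_lineBundle k₂) R
    (g := E₁.projComp E₂ k₁ φ hΨ ζ hζ) (E₁.lineBundleMapEquiv E₂ k₁ k₂ φ hΨ ζ hζ) (E₁.continuous_lineBundleMap E₂ k₁ k₂ φ hΨ ζ hζ) m

end Map

end ComplexVectorBundle

end Literature.AlgebraicTopology.CharacteristicClasses
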